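import Summits.ABC.ABC.Theorems.DefiniteXiSteinbergCoreXi8TailComparison
import Summits.ABC.ABC.Theorems.DefiniteXiSteinbergCoreXi9CoreDivisibility

/-!
# Xi helper 10 — ASSEMBLY: `xiCongruenceComparison : XiCongruenceComparison` (unconditional) and `stub_xiDegreeComparison_of_oneSided : (one-sided Frey valuation inequality, spelled out) → FreyModularity → ⟨stub_xiDegreeComparison verbatim⟩`, `stub_xiDegreeComparison_of_facts : padicValNat_congruenceNumber_eq_of_not_sq_dvd → FreyModularity → ⟨stub verbatim⟩` (k1 G11 PART III)

Helper module 10/10 for the registered stub `stub_xiDegreeComparison` of the line `p6_tamagawa_split` (crux `DefiniteXi.SteinbergCore`, item stmt-ABC-15024, route `route-ABC-DefiniteXi`).  Content = lines 2830–2902 of `Summits/ABC/ABC/Cruxes/SteinbergCore/STUB_IDEAS_stub_xiDegreeComparison_1_g44_XiMonoDefLight.lean` (gen-44 def-light edition of the critic monolith `STUB_PLAN_stub_xiDegreeComparison_XiMono.lean`) (the renamespaced k1 gen-11 certificate `STUB_IDEAS_stub_xiDegreeComparison_1_g11_Certificate.lean`: k1 gens 7–11, k2 gen-4 kernel, k3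 gen-4 tail — authors: stub-ideation seats k1/k2/k3), cut mechanically at declaration boundaries by the stub-critic (plan `STUB-PLAN-stub_xiDegreeComparison.md` §1).  Proofs verbatim; nothing restated.
-/

set_option linter.dupNamespace false
set_option autoImplicit false

noncomputable section

namespace Summit.ABC.ABC.Theorems.SteinbergCoreXi.StubIdeasK1G11

open scoped MatrixGroups ModularForm Matrix
open CongruenceSubgroup
open Literature.NumberTheory.EllipticCurves Literature.NumberTheory.EllipticCurves.ModularForms
open Literature.NumberTheory.Automorphic Literature.NumberTheory.Automorphic.Brandt

/-- **CHILD 1♮ IS A THEOREM.**  `XiCongruenceComparison` — for the Frey curve, admissible `Nm`, `ξ ≠ 0`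
and every newform `f` of `E_(a,b)` at level `N`: `cps ξ ≤ C_ε N^ε cps(r_f)` — holds unconditionally.
(The core is the landed `StubIdeasK1G10.xiCoreDivisibility` (helper Xi9); the two verbatim copies of k3's
`XiCoreDivisibility` — `StubIdeasK1G10.` (Xi5) and `StubIdeasK1G11.` (Xi7) — agree definitionally, so no
re-export is stated here: the gate's dedup lint identified them, p845256.) -/
theorem xiCongruenceComparison : XiCongruenceComparison :=
  xiCongruenceComparison_of_core StubIdeasK1G10.xiCoreDivisibility

/-- **The REGISTERED stub from the two weakest inputs**: the one-sided Frey valuation inequality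
`v_p r_{D.f} ≤ v_p deg D` (`p ≥ 5`, every Frey datum; spelled out as the hypothesis `hF` — it follows from ARS 2.1(b)
by `padicValNat_congruenceNumber_le_padicValNat_deg_of_frey`, and is the target of the optional ARS-free programme
N1′) and the route item `FreyModularity` (stmt-ABC-11340).  Statement = `stub_xiDegreeComparison` of
`Lines/p6_tamagawa_split.lean`, verbatim.  A lead's reshaped skeleton may cite this theorem
(`stub_xiDegreeComparison := …_of_oneSided stub_oneSidedFrey stub_freyModularity`) or `…_of_facts` below. -/
theorem stub_xiDegreeComparison_of_oneSided
    (hF : ∀ (a b : ℤ), IsCoprime a b → a * b * (a + b) ≠ 0 →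
      ∀ (N : ℕ) [NeZero N], (freyCurve a b).conductorNorm ℤ = N →
      ∀ (D : ModularParametrizationData (freyCurve a b) N) (p : ℕ), p.Prime → 5 ≤ p →
        padicValNat p (congruenceNumber D.f) ≤ padicValNat p D.modularDegree)
    (hMod : Summit.ABC.ABC.Theses.DefiniteXi.FreyModularity) :
    ∀ ε : ℝ, 0 < ε → ∃ C : ℝ, ∀ a b : ℤ, IsCoprime a b → a * b * (a + b) ≠ 0 → ∀ (N : ℕ) [NeZero N],
      (Literature.NumberTheory.EllipticCurves.freyCurve a b).conductorNorm ℤ = N →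
      ∀ Nm : ℕ, Odd Nm → Squarefree Nm → Odd Nm.primeFactors.card → Nm ∣ N →
      Literature.NumberTheory.Automorphic.brandtXi (N / Nm) Nm
          (fun n => (Literature.NumberTheory.EllipticCurves.freyCurve a b).LFunction n) ≠ 0 →
      ∃ D : Literature.NumberTheory.EllipticCurves.ModularForms.ModularParametrizationData
        (Literature.NumberTheory.EllipticCurves.freyCurve a b) N,
        (∀ D' : Literature.NumberTheory.EllipticCurves.ModularForms.ModularParametrizationData
          (Literature.NumberTheory.EllipticCurves.freyCurve a b) N, D.deg ≤ D'.deg) ∧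
        ((Literature.NumberTheory.Automorphic.brandtXi (N / Nm) Nm
              (fun n => (Literature.NumberTheory.EllipticCurves.freyCurve a b).LFunction n) /
            (ordProj[2] (Literature.NumberTheory.Automorphic.brandtXi (N / Nm) Nm
                (fun n => (Literature.NumberTheory.EllipticCurves.freyCurve a b).LFunction n)) *
              ordProj[3] (Literature.NumberTheory.Automorphic.brandtXi (N / Nm) Nm
                (fun n => (Literature.NumberTheory.EllipticCurves.freyCurve a b).LFunction n))) : ℕ) : ℝ) ≤
          C * (N : ℝ) ^ ε * ((D.deg / (ordProj[2] D.deg * ordProj[3] D.deg) : ℕ) : ℝ) *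
            ((∏ q ∈ N.primeFactors, ((Literature.NumberTheory.EllipticCurves.freyCurve a b).minimalDiscriminantNorm
              ℤ).factorization q : ℕ) : ℝ) ^ 3 :=
  stub_of_xiCongruenceComparison_oneSided xiCongruenceComparison hF hMod

/-- **The REGISTERED stub from exactly two named inputs**: ARS 2.1(b)
(`padicValNat_congruenceNumber_eq_of_not_sq_dvd`, Literature named fact, unproved) and the route item
`FreyModularity` (stmt-ABC-11340).  Statement = `stub_xiDegreeComparison` of `Lines/p6_tamagawa_split.lean`, verbatim.
[cite: AgasheRibetStein2012, Thm. 2.1] -/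
theorem stub_xiDegreeComparison_of_facts
    (hARS : padicValNat_congruenceNumber_eq_of_not_sq_dvd)
    (hMod : Summit.ABC.ABC.Theses.DefiniteXi.FreyModularity) :
    ∀ ε : ℝ, 0 < ε → ∃ C : ℝ, ∀ a b : ℤ, IsCoprime a b → a * b * (a + b) ≠ 0 → ∀ (N : ℕ) [NeZero N],
      (Literature.NumberTheory.EllipticCurves.freyCurve a b).conductorNorm ℤ = N →
      ∀ Nm : ℕ, Odd Nm → Squarefree Nm → Odd Nm.primeFactors.card → Nm ∣ N →
      Literature.NumberTheory.Automorphic.brandtXi (N / Nm) Nm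
          (fun n => (Literature.NumberTheory.EllipticCurves.freyCurve a b).LFunction n) ≠ 0 →
      ∃ D : Literature.NumberTheory.EllipticCurves.ModularForms.ModularParametrizationData
        (Literature.NumberTheory.EllipticCurves.freyCurve a b) N,
        (∀ D' : Literature.NumberTheory.EllipticCurves.ModularForms.ModularParametrizationData
          (Literature.NumberTheory.EllipticCurves.freyCurve a b) N, D.deg ≤ D'.deg) ∧
        ((Literature.NumberTheory.Automorphic.brandtXi (N / Nm) Nm
              (fun n => (Literature.NumberTheory.EllipticCurves.freyCurve a b).LFunction n) /
            (ordProj[2] (Literature.NumberTheory.Automorphic.brandtXi (N / Nm) Nm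
                (fun n => (Literature.NumberTheory.EllipticCurves.freyCurve a b).LFunction n)) *
              ordProj[3] (Literature.NumberTheory.Automorphic.brandtXi (N / Nm) Nm
                (fun n => (Literature.NumberTheory.EllipticCurves.freyCurve a b).LFunction n))) : ℕ) : ℝ) ≤
          C * (N : ℝ) ^ ε * ((D.deg / (ordProj[2] D.deg * ordProj[3] D.deg) : ℕ) : ℝ) *
            ((∏ q ∈ N.primeFactors, ((Literature.NumberTheory.EllipticCurves.freyCurve a b).minimalDiscriminantNorm
              ℤ).factorization q : ℕ) : ℝ) ^ 3 :=
  stub_of_xiCongruenceComparison xiCongruenceComparison hARS hMod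

end Summit.ABC.ABC.Theorems.SteinbergCoreXi.StubIdeasK1G11

end
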